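import Summits.AnomalousDissipation.AnomalousDissipation.Theorems.TaylorCertificatesForcedStandingFlowsStep
import Literature.Analysis.FluidPDE.ConvexIntegration2DIteration
import HarnessLib

/-!
# Route TaylorCertificates — support `ForcedStandingFlows`: the iteration from an affine subsolution

Helper file for the item `stmt-AnomalousDissipation-14031` (`ForcedStandingFlows`). The tree's
`StationaryEuler.IterData` (Choffrut–Székelyhidi 2014, §2, Step 3, run as an explicit iteration)
starts from a field `w₀ ∈ X₀`, i.e. a smooth strict subsolution of the HOMOGENEOUS linear system.
Here the same iteration `w_{k+1} = w_k + W_k` is run from an arbitrary smooth field `w₀` with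
values in the relaxed sets `𝒰_{e(x)}` (an affine strict subsolution, e.g. `(f, ℛf)` for the forced
problem `div (v ⊗ v) + ∇p = f`): the increments `W_k` of `ForcedFlows.step'` are homogeneous weak
subsolutions, so all weak identities of the states, and all their coordinate means, are those of
`w₀`; and the increments are nearly orthogonal to one extra continuous test field `q` (for the
forced problem `q = (f, 0)`, which controls the work `(f, v)`). Energies and the `L²` Cauchy property are verbatim the tree's (`StationaryEulerIteration`); the
file ends with the `L²`-fast subsequence and the a.e. limit state `wlim` (as in
`StationaryEulerLimit`), whose properties are established in the companion files
`…Identities`, `…Limit`.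

## References

* A. Choffrut, L. Székelyhidi Jr., SIAM J. Math. Anal. 46 (2014) = arXiv:1401.4301, §2, Step 3.
* L. Székelyhidi Jr., *From isometric embeddings to turbulence*, Lecture notes (2012), §5–6.
-/

noncomputable section

open scoped InnerProductSpace ContDiff ENNReal Topology
open Set Function MeasureTheory Metric Filter
open Literature.Analysis.FunctionSpaces Literature.Analysis.FluidPDE
open Literature.Analysis.FluidPDE.StationaryEuler

namespace Summit.AnomalousDissipation.AnomalousDissipation.Theorems

-- the mandated namespace `Summit.<Summit>.<Problem>.Theorems` repeats `AnomalousDissipation` (single-problem summit)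
set_option linter.dupNamespace false

namespace ForcedFlows

variable {d : Type*} [Fintype d] [DecidableEq d] [Nonempty d]

/-! ## The data of a run -/

/-- The fixed data of one run of the forced iteration: the relaxed family, the continuous energy
profile `e`, a smooth initial field `w₀` with values in `𝒰_{e(x)}` (no weak identity is assumed),
one extra continuous test field `q`, and the tolerance `θ > 0`. [cite: ChoffrutSzekelyhidi2014, §2] -/
structure FIterData (d : Type*) [Fintype d] [DecidableEq d] [Nonempty d] where
  /-- the relaxed sets -/
  𝓕 : RelaxedFamily d
  /-- the energy profile -/
  e : UnitAddTorus d → ℝ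
  /-- the initial field -/
  w₀ : UnitAddTorus d → State d
  /-- the extra test field -/
  q : UnitAddTorus d → State d
  /-- the tolerance -/
  θ : ℝ
  he : Continuous e
  hw₀ : Torus.IsSmooth w₀
  hw₀U : ∀ x, w₀ x ∈ 𝓕.U (e x)
  hq : Continuous q
  hθ : 0 < θ

namespace FIterData

variable (D : FIterData d)

/-- The tolerance at stage `k`: `ε_k = θ 2^{-(k+1)}`. [folklore] -/
def eps (k : ℕ) : ℝ := D.θ / 2 ^ (k + 1)

/-- The tolerances are positive. [folklore] -/
theorem eps_pos (k : ℕ) : 0 < D.eps k := by unfold eps; have := D.hθ; positivity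

/-- The tolerances are non-negative. [folklore] -/
theorem eps_nonneg (k : ℕ) : 0 ≤ D.eps k := (D.eps_pos k).le

/-- The tolerances form a geometric sequence. [folklore] -/
theorem eps_eq (k : ℕ) : D.eps k = D.θ / 2 * (1 / 2) ^ k := by
  rw [eps, one_div, inv_pow, pow_succ]; ring

/-- The tolerances are summable. [folklore] -/
theorem summable_eps : Summable D.eps := by
  rw [show D.eps = fun k => D.θ / 2 * (1 / 2) ^ k from funext D.eps_eq]
  exact (summable_geometric_of_lt_one (by norm_num) (by norm_num)).mul_left _

/-- `∑ ε_k = θ`. [folklore] -/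
theorem tsum_eps : ∑' k, D.eps k = D.θ := by
  rw [show D.eps = fun k => D.θ / 2 * (1 / 2) ^ k from funext D.eps_eq, tsum_mul_left,
    tsum_geometric_of_lt_one (by norm_num) (by norm_num)]
  ring

/-- Partial sums of the tolerances are at most `θ`. [folklore] -/
theorem sum_eps_le (s : Finset ℕ) : ∑ k ∈ s, D.eps k ≤ D.θ := by
  rw [← D.tsum_eps]; exact D.summable_eps.sum_le_tsum s fun k _ => D.eps_nonneg k

/-! ## The iteration -/

/-- The specification of the increment at stage `k` (an instance of `step'`, with the previous
states and `q` as test fields). [cite: ChoffrutSzekelyhidi2014, §2, Step 3] -/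
theorem step_spec (k : ℕ) (H : {H : Fin (k + 1) → UnitAddTorus d → State d //
      ∀ j, Torus.IsSmooth (H j) ∧ ∀ x, H j x ∈ D.𝓕.U (D.e x)}) :
    ∃ W : UnitAddTorus d → State d, Torus.IsSmooth W ∧ IsTorusSub W ∧
      (∀ x, H.1 (Fin.last k) x + W x ∈ D.𝓕.U (D.e x)) ∧
      (∀ j, |∫ x, ⟪W x, H.1 j x⟫_ℝ| ≤ D.eps k) ∧ |∫ x, ⟪W x, D.q x⟫_ℝ| ≤ D.eps k ∧
      (∀ c, ∫ x, W x c = 0) ∧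
      defect D.e (H.1 (Fin.last k)) - D.eps k ≤ ∫ x, ‖W x‖ ^ 2 := by
  set p : Fin (k + 2) → UnitAddTorus d → State d :=
    Fin.snoc (α := fun _ => UnitAddTorus d → State d) H.1 D.q with hp
  have hpc : ∀ a, Continuous (p a) := fun a => by
    refine Fin.lastCases ?_ (fun j => ?_) a
    · rw [hp, Fin.snoc_last]; exact D.hq
    · rw [hp, Fin.snoc_castSucc]; exact (H.2 j).1.continuous
  obtain ⟨W, hW, hsub, hmem, horth, hmean, hgain⟩ :=
    step' D.𝓕 D.he (H.2 (Fin.last k)).1 (H.2 (Fin.last k)).2 p hpc (D.eps_pos k)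
  refine ⟨W, hW, hsub, hmem, fun j => ?_, ?_, hmean, hgain⟩
  · have := horth j.castSucc
    rwa [hp, Fin.snoc_castSucc] at this
  · have := horth (Fin.last (k + 1))
    rwa [hp, Fin.snoc_last] at this

/-- **The iteration** (history form). [cite: ChoffrutSzekelyhidi2014, §2, Step 3] -/
def seqAux : (k : ℕ) → {H : Fin (k + 1) → UnitAddTorus d → State d //
    ∀ j, Torus.IsSmooth (H j) ∧ ∀ x, H j x ∈ D.𝓕.U (D.e x)}
  | 0 => ⟨fun _ => D.w₀, fun _ => ⟨D.hw₀, D.hw₀U⟩⟩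
  | k + 1 =>
    ⟨Fin.snoc (α := fun _ => UnitAddTorus d → State d) (seqAux k).1
        (fun x => (seqAux k).1 (Fin.last k) x + Classical.choose (D.step_spec k (seqAux k)) x), by
      intro j
      refine Fin.lastCases ?_ (fun i => ?_) j
      · rw [Fin.snoc_last]
        have hs := Classical.choose_spec (D.step_spec k (seqAux k))
        have hH := (seqAux k).2 (Fin.last k)
        exact ⟨hH.1.add hs.1, hs.2.2.1⟩
      · rw [Fin.snoc_castSucc]
        exact (seqAux k).2 i⟩

/-- The `k`-th state `w_k`. [folklore] -/
def state (k : ℕ) : UnitAddTorus d → State d := (D.seqAux k).1 (Fin.last k)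

/-- The `k`-th increment `W_k`. [folklore] -/
def incr (k : ℕ) : UnitAddTorus d → State d := Classical.choose (D.step_spec k (D.seqAux k))

/-- `w_0 = w₀`. [folklore] -/
theorem state_zero : D.state 0 = D.w₀ := rfl

/-- `w_{k+1} = w_k + W_k`. [folklore] -/
theorem state_succ (k : ℕ) : D.state (k + 1) = fun x => D.state k x + D.incr k x := by
  show (D.seqAux (k + 1)).1 (Fin.last (k + 1)) = _
  simp only [seqAux, Fin.snoc_last]
  rfl

/-- `w_{k+1}(x) = w_k(x) + W_k(x)`. [folklore] -/
theorem state_succ_apply (k : ℕ) (x : UnitAddTorus d) : D.state (k + 1) x = D.state k x + D.incr k x := by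
  rw [D.state_succ]

/-- Earlier entries of the history are the earlier states. [folklore] -/
theorem seqAux_castSucc (k : ℕ) (j : Fin (k + 1)) : (D.seqAux (k + 1)).1 j.castSucc = (D.seqAux k).1 j := by
  show Fin.snoc (α := fun _ => UnitAddTorus d → State d) (D.seqAux k).1 _ j.castSucc = _
  rw [Fin.snoc_castSucc]

/-- The history consists of the states. [folklore] -/
theorem seqAux_eq_state (k : ℕ) (j : Fin (k + 1)) : (D.seqAux k).1 j = D.state j := by
  induction k with
  | zero => fin_cases j; rfl
  | succ k ih =>
    refine Fin.lastCases ?_ (fun i => ?_) j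
    · rfl
    · rw [D.seqAux_castSucc k i, ih i]; rfl

/-- **All states are smooth.** [folklore] -/
theorem state_smooth (k : ℕ) : Torus.IsSmooth (D.state k) := ((D.seqAux k).2 (Fin.last k)).1

/-- **All states take values in the relaxed sets.** [cite: ChoffrutSzekelyhidi2014, §2, Step 3] -/
theorem state_mem (k : ℕ) (x : UnitAddTorus d) : D.state k x ∈ D.𝓕.U (D.e x) := ((D.seqAux k).2 (Fin.last k)).2 x

/-- The states take values in `𝒦^{co}_{e(x)}`. [folklore] -/
theorem state_mem_C (k : ℕ) (x : UnitAddTorus d) : D.state k x ∈ C (D.e x) := D.𝓕.subset_C _ (D.state_mem k x)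

/-- The increments are smooth. [folklore] -/
theorem incr_smooth (k : ℕ) : Torus.IsSmooth (D.incr k) := (Classical.choose_spec (D.step_spec k (D.seqAux k))).1

/-- **The increments are homogeneous weak subsolutions.** [folklore] -/
theorem incr_isTorusSub (k : ℕ) : IsTorusSub (D.incr k) := (Classical.choose_spec (D.step_spec k (D.seqAux k))).2.1

/-- **Near-orthogonality of the increments to all previous states.** [folklore] -/
theorem incr_orth_state {k j : ℕ} (hj : j ≤ k) : |∫ x, ⟪D.incr k x, D.state j x⟫_ℝ| ≤ D.eps k := by
  have h := (Classical.choose_spec (D.step_spec k (D.seqAux k))).2.2.2.1 ⟨j, Nat.lt_succ_of_le hj⟩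
  simp only [D.seqAux_eq_state] at h
  exact h

/-- **Near-orthogonality of the increments to the extra test field.** [folklore] -/
theorem incr_orth_q (k : ℕ) : |∫ x, ⟪D.incr k x, D.q x⟫_ℝ| ≤ D.eps k :=
  (Classical.choose_spec (D.step_spec k (D.seqAux k))).2.2.2.2.1

/-- **The coordinate means of the increments vanish.** [folklore] -/
theorem integral_incr_apply (k : ℕ) (c : Idx d) : ∫ x, D.incr k x c = 0 :=
  (Classical.choose_spec (D.step_spec k (D.seqAux k))).2.2.2.2.2.1 c

/-- **The gain of the increments.** [folklore] -/
theorem incr_gain (k : ℕ) : defect D.e (D.state k) - D.eps k ≤ ∫ x, ‖D.incr k x‖ ^ 2 :=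
  (Classical.choose_spec (D.step_spec k (D.seqAux k))).2.2.2.2.2.2

/-! ## Bounds and energies -/

/-- The states are continuous. [folklore] -/
theorem state_continuous (k : ℕ) : Continuous (D.state k) := (D.state_smooth k).continuous

/-- The increments are continuous. [folklore] -/
theorem incr_continuous (k : ℕ) : Continuous (D.incr k) := (D.incr_smooth k).continuous

/-- The maximum `ē` of the energy profile. [folklore] -/
def ebar : ℝ := ⨆ x, D.e x

/-- `e ≤ ē`. [folklore] -/
theorem e_le_ebar (x : UnitAddTorus d) : D.e x ≤ D.ebar := le_ciSup (isCompact_range D.he).bddAbove x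

/-- `0 ≤ e` (the relaxed sets are empty at negative energies). [folklore] -/
theorem e_nonneg (x : UnitAddTorus d) : 0 ≤ D.e x := nonneg_of_mem_C (D.state_mem_C 0 x)

/-- `|v_k(x)|² ≤ e(x)`. [cite: ChoffrutSzekelyhidi2014, §2, Step 1] -/
theorem norm_vel_state_sq_le (k : ℕ) (x : UnitAddTorus d) : ‖vel (D.state k x)‖ ^ 2 ≤ D.e x :=
  norm_vel_sq_le_of_mem_C (D.state_mem_C k x)

/-- The uniform bound `R = √ē + 3 ē d` on all states. [cite: ChoffrutSzekelyhidi2014, §2, Step 1] -/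
def R : ℝ := Real.sqrt D.ebar + 3 * D.ebar * Fintype.card d

/-- **All states are bounded by `R`.** [cite: ChoffrutSzekelyhidi2014, §2, Step 1] -/
theorem norm_state_le (k : ℕ) (x : UnitAddTorus d) : ‖D.state k x‖ ≤ D.R := by
  have h1 := norm_le_of_mem_C (D.state_mem_C k x)
  have h0 := D.e_nonneg x
  calc ‖D.state k x‖ ≤ Real.sqrt (D.e x) + 3 * D.e x * Fintype.card d := h1
    _ ≤ Real.sqrt D.ebar + 3 * D.ebar * Fintype.card d := by
        gcongr
        · exact D.e_le_ebar x
        · exact D.e_le_ebar x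

/-- `R ≥ 0`. [folklore] -/
theorem R_nonneg : 0 ≤ D.R := by
  obtain ⟨x⟩ : Nonempty (UnitAddTorus d) := inferInstance
  exact (norm_nonneg _).trans (D.norm_state_le 0 x)

/-- The `L²` pairing of state fields. [folklore] -/
def ip (u v : UnitAddTorus d → State d) : ℝ := ∫ x, ⟪u x, v x⟫_ℝ

omit [DecidableEq d] [Nonempty d] in
/-- The pairing is symmetric. [folklore] -/
theorem ip_comm (u v : UnitAddTorus d → State d) : ip u v = ip v u := by
  simp only [ip, real_inner_comm]

omit [DecidableEq d] [Nonempty d] in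
/-- `⟨u, u⟩ = ∫ ‖u‖²`. [folklore] -/
theorem ip_self (u : UnitAddTorus d → State d) : ip u u = ∫ x, ‖u x‖ ^ 2 := by
  simp only [ip, real_inner_self_eq_norm_sq]

omit [DecidableEq d] [Nonempty d] in
/-- `⟨u, u⟩ ≥ 0`. [folklore] -/
theorem ip_self_nonneg (u : UnitAddTorus d → State d) : 0 ≤ ip u u := by
  rw [ip_self]; exact integral_nonneg fun x => by positivity

/-- The energy `E_k = ‖w_k‖²_{L²}`. [folklore] -/
def E (k : ℕ) : ℝ := ip (D.state k) (D.state k)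

/-- `E_{k+1} = E_k + 2⟨w_k, W_k⟩ + ‖W_k‖²`. [folklore] -/
theorem E_succ (k : ℕ) : D.E (k + 1) = D.E k + 2 * ip (D.state k) (D.incr k) + ip (D.incr k) (D.incr k) := by
  simp only [E, ip]
  have h1 : Integrable fun x => ⟪D.state k x, D.state k x⟫_ℝ := ((D.state_continuous k).inner (D.state_continuous k)).integrable_unitAddTorus
  have h2 : Integrable fun x => ⟪D.state k x, D.incr k x⟫_ℝ := ((D.state_continuous k).inner (D.incr_continuous k)).integrable_unitAddTorus
  have h3 : Integrable fun x => ⟪D.incr k x, D.incr k x⟫_ℝ := ((D.incr_continuous k).inner (D.incr_continuous k)).integrable_unitAddTorus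
  have : (fun x => ⟪D.state (k + 1) x, D.state (k + 1) x⟫_ℝ) =
      fun x => ⟪D.state k x, D.state k x⟫_ℝ + 2 * ⟪D.state k x, D.incr k x⟫_ℝ + ⟪D.incr k x, D.incr k x⟫_ℝ := by
    funext x
    rw [D.state_succ_apply, inner_add_left, inner_add_right, inner_add_right, real_inner_comm (D.incr k x) (D.state k x)]
    ring
  have h12 : Integrable fun x => ⟪D.state k x, D.state k x⟫_ℝ + 2 * ⟪D.state k x, D.incr k x⟫_ℝ := h1.add (h2.const_mul 2)
  rw [this, integral_add h12 h3, integral_add h1 (h2.const_mul 2), integral_const_mul]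

/-- `|⟨W_k, w_j⟩| ≤ ε_k` for `j ≤ k`. [folklore] -/
theorem abs_ip_incr_state_le {k j : ℕ} (hj : j ≤ k) : |ip (D.incr k) (D.state j)| ≤ D.eps k := D.incr_orth_state hj

/-- The energies are bounded: `E_k ≤ R²`. [folklore] -/
theorem E_le (k : ℕ) : D.E k ≤ D.R ^ 2 := by
  rw [E, ip_self]
  calc ∫ x, ‖D.state k x‖ ^ 2 ≤ ∫ _ : UnitAddTorus d, D.R ^ 2 := by
        refine integral_mono ((D.state_continuous k).norm.pow 2).integrable_unitAddTorus (integrable_const _) fun x => ?_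
        exact pow_le_pow_left₀ (norm_nonneg _) (D.norm_state_le k x) 2
    _ = D.R ^ 2 := by simp

/-- The corrected energies `F_k = E_k + 2 Σ_{i<k} ε_i`. [folklore] -/
def F (k : ℕ) : ℝ := D.E k + 2 * ∑ i ∈ Finset.range k, D.eps i

/-- The corrected energies are non-decreasing. [folklore] -/
theorem F_monotone : Monotone D.F := by
  refine monotone_nat_of_le_succ fun k => ?_
  simp only [F, Finset.sum_range_succ, D.E_succ]
  have h1 := D.abs_ip_incr_state_le (le_refl k)
  rw [ip_comm] at h1
  have h2 := ip_self_nonneg (D.incr k)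
  have := neg_abs_le (ip (D.state k) (D.incr k))
  linarith

/-- The corrected energies are bounded. [folklore] -/
theorem F_le (k : ℕ) : D.F k ≤ D.R ^ 2 + 2 * D.θ := by
  unfold F; linarith [D.E_le k, D.sum_eps_le (Finset.range k)]

/-- **`‖w_m - w_n‖²_{L²} ≤ F_m - F_n` for `n ≤ m`.** [folklore] -/
theorem ip_sub_le (n m : ℕ) (hnm : n ≤ m) :
    ip (fun x => D.state m x - D.state n x) (fun x => D.state m x - D.state n x) ≤ D.F m - D.F n := by
  have key : ∀ j : ℕ, ip (fun x => D.state (n + j) x - D.state n x) (fun x => D.state (n + j) x - D.state n x) =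
      D.E (n + j) - D.E n - 2 * ∑ k ∈ Finset.range j, ip (D.incr (n + k)) (D.state n) := by
    intro j
    induction j with
    | zero => simp [ip, E]
    | succ j ih =>
      rw [Finset.sum_range_succ, ← add_assoc, D.E_succ (n + j)]
      have hX : ip (fun x => D.state (n + j + 1) x - D.state n x) (fun x => D.state (n + j + 1) x - D.state n x) =
          ip (fun x => D.state (n + j) x - D.state n x) (fun x => D.state (n + j) x - D.state n x) +
            2 * (ip (D.state (n + j)) (D.incr (n + j)) - ip (D.incr (n + j)) (D.state n)) +
            ip (D.incr (n + j)) (D.incr (n + j)) := by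
        simp only [ip]
        set W := D.incr (n + j)
        set a := D.state (n + j)
        set b := D.state n
        have hW : Continuous W := D.incr_continuous _
        have ha : Continuous a := D.state_continuous _
        have hb : Continuous b := D.state_continuous _
        have i1 : Integrable fun x => ⟪a x - b x, a x - b x⟫_ℝ := ((ha.sub hb).inner (ha.sub hb)).integrable_unitAddTorus
        have i2 : Integrable fun x => ⟪a x, W x⟫_ℝ := (ha.inner hW).integrable_unitAddTorus
        have i3 : Integrable fun x => ⟪W x, b x⟫_ℝ := (hW.inner hb).integrable_unitAddTorus
        have i4 : Integrable fun x => ⟪W x, W x⟫_ℝ := (hW.inner hW).integrable_unitAddTorus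
        have : (fun x => ⟪D.state (n + j + 1) x - b x, D.state (n + j + 1) x - b x⟫_ℝ) =
            fun x => ⟪a x - b x, a x - b x⟫_ℝ + 2 * (⟪a x, W x⟫_ℝ - ⟪W x, b x⟫_ℝ) + ⟪W x, W x⟫_ℝ := by
          funext x
          have hs : D.state (n + j + 1) x = a x + W x := D.state_succ_apply (n + j) x
          rw [hs]
          simp only [inner_add_left, inner_add_right, inner_sub_left, inner_sub_right, real_inner_comm (W x) (a x),
            real_inner_comm (b x) (W x), real_inner_comm (b x) (a x)]
          ring
        have i23 : Integrable fun x => 2 * (⟪a x, W x⟫_ℝ - ⟪W x, b x⟫_ℝ) := (i2.sub i3).const_mul 2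
        have i123 : Integrable fun x => ⟪a x - b x, a x - b x⟫_ℝ + 2 * (⟪a x, W x⟫_ℝ - ⟪W x, b x⟫_ℝ) := i1.add i23
        rw [this, integral_add i123 i4, integral_add i1 i23, integral_const_mul, integral_sub i2 i3]
      rw [hX, ih]
      ring
  obtain ⟨j, rfl⟩ := Nat.exists_eq_add_of_le hnm
  rw [key j]
  simp only [F, Finset.sum_range_add]
  have hb : ∀ k ∈ Finset.range j, -ip (D.incr (n + k)) (D.state n) ≤ D.eps (n + k) :=
    fun k _ => (neg_le_abs _).trans (D.abs_ip_incr_state_le (Nat.le_add_right n k))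
  have hs := Finset.sum_le_sum hb
  rw [Finset.sum_neg_distrib] at hs
  linarith

/-- **The states form a Cauchy sequence in `L²`** (monotone bounded corrected energies, as in the
tree's `ConvexIntegration.exists_forall_sub_lt_of_monotone`). [cite: ChoffrutSzekelyhidi2014, §2, Step 3] -/
theorem cauchy {η : ℝ} (hη : 0 < η) :
    ∃ M : ℕ, ∀ n m, M ≤ n → n ≤ m → ∫ x, ‖D.state m x - D.state n x‖ ^ 2 < η := by
  obtain ⟨M, hM⟩ := ConvexIntegration.exists_forall_sub_lt_of_monotone D.F_monotone D.F_le hη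
  refine ⟨M, fun n m hn hnm => ?_⟩
  have h := (D.ip_sub_le n m hnm).trans_lt (hM n m hn hnm)
  rwa [ip_self] at h

/-! ## An `L²`-fast subsequence -/

/-- Thresholds of the Cauchy property at level `4^{-i}`. [folklore] -/
def thr (i : ℕ) : ℕ := Classical.choose (D.cauchy (η := (1 / 4) ^ i) (by positivity))

/-- The defining property of the thresholds. [folklore] -/
theorem thr_spec (i : ℕ) : ∀ n m, D.thr i ≤ n → n ≤ m → ∫ x, ‖D.state m x - D.state n x‖ ^ 2 < (1 / 4) ^ i :=
  Classical.choose_spec (D.cauchy (η := (1 / 4) ^ i) (by positivity))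

/-- The subsequence: strictly increasing and above the thresholds. [folklore] -/
def sub : ℕ → ℕ
  | 0 => D.thr 0
  | i + 1 => max (sub i + 1) (D.thr (i + 1))

/-- The subsequence dominates the thresholds. [folklore] -/
theorem thr_le_sub (i : ℕ) : D.thr i ≤ D.sub i := by
  cases i with
  | zero => exact le_rfl
  | succ i => exact le_max_right _ _

/-- The subsequence is strictly increasing. [folklore] -/
theorem sub_lt_sub_succ (i : ℕ) : D.sub i < D.sub (i + 1) :=
  Nat.lt_of_lt_of_le (Nat.lt_succ_self _) (le_max_left _ _)

/-- The subsequence is strictly monotone. [folklore] -/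
theorem sub_strictMono : StrictMono D.sub := strictMono_nat_of_lt_succ D.sub_lt_sub_succ

/-- **The limit state** `w = lim w_{φ(i)}` (a.e.; junk elsewhere). [cite: ChoffrutSzekelyhidi2014, §2, Step 3] -/
def wlim (x : UnitAddTorus d) : State d := limUnder atTop fun i => D.state (D.sub i) x

end FIterData

end ForcedFlows

end Summit.AnomalousDissipation.AnomalousDissipation.Theorems
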